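import Literature.AnabelianGeometry.EtaleTheta.Discharge.Sec3Cor38OfRankOnePoint
import Literature.AnabelianGeometry.EtaleTheta.Discharge.Sec3Cor38iiiKnitRankOnePointTateTower
import Literature.AnabelianGeometry.EtaleTheta.Discharge.Sec3Cor38iiiOfGaloisCoveringConnectedKnit
import Literature.AnabelianGeometry.EtaleTheta.Discharge.Sec3Prop34ConstTateTower
import Literature.AnabelianGeometry.EtaleTheta.Discharge.Sec3Prop34ConstOneComp
import HarnessLib

/-!
# [EtTh] Corollary 3.8 (i) ∧ (ii) ∧ (iii) AS TYPED with NO binder at the cell's NON-DEGENERATE constructed tempered Frobenioids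
# (the Tate tower = model of record, and the one-component model), and for every rank-one point / every tempered Frobenioid
# with print's `Φ` over the constructed connected data modulo `Prop34Const` alone

S. Mochizuki, *The étale theta function and its Frobenioid-theoretic manifestations*, Publ. RIMS **45** (2009), Cor. 3.8
(i)–(iii), statement PDF p. 80, proof pp. 81–82 [cite: MochizukiEtTh2009, Cor 3.8 p.80]; Def. 3.3 (iii) p. 73, Prop. 3.4 (ii) p. 74,
Def. 3.6 (i)/(ii) pp. 76–77, Ex. 3.9 (iii) p. 84.

abc-iut cell, layer L2, cone nodes `EtTh:Cor3.8(i)` / `(ii)` / `(iii)`, seat abc-iut-L2-d2 (gen 5).  PROOF-ONLY (0 definitions) —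
the ASSEMBLY sequel of this seat's `Discharge/Sec3Cor38OfGaloisCoveringConnected.lean` (p449574: (i)/(ii) for every tempered
Frobenioid with print's `Φ` over `ofRlfZWeak (ofGaloisActionConnected A hZ) hpf`, residual `Prop34Const` + Φ-tie),
`Discharge/Sec3Cor38OfRankOnePoint.lean` (p449948: (i)/(ii) with NO binder at every rank-one point, at `TateTowerFrd.temperedFrobenioid`
and at `OneCompFrd.temperedFrobenioidWeak`) and `Discharge/Sec3Prop34ConstOneComp.lean` (p449874: `Prop34Const` at the
one-component data), with abc-iut-w6-d052's Cor. 3.8 (iii) knits `cor38_iii_ofGaloisActionConnected_of_isOfFSMType_of_eq_mrange` /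
`…_connectedPart_bTemp_of_eq_mrange` (p444329), `TemperedFrobenioid.cor38_iii_ofRankOnePoint` /
`LogDivisorModel.TateTower.cor38_iii_tateTowerFrd` (p451056, R365) and `LogDivisorModel.TateTower.prop34Const_ofGaloisActionConnected`
(p448109) — everything BY NAME, nothing restated:

* §1 generic connected data: `Cor38Hyp.cor38_ofGaloisActionConnected_of_isOfFSMType_of_eq_mrange` /
  `…_connectedPart_bTemp_of_eq_mrange : Cor38_i … h ∧ Cor38_ii … h ∧ Cor38_iii h` — residual = `h`, the Φ-ties (print's `Φ`),
  `Prop34Const_i`, [`IsOfFSMType D_i`] — NOTHING ELSE (at the genuine bases `B^temp(Π)⁰`: `h`, Φ-ties, `Prop34Const_i`);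
* §2 rank-one points: `TemperedFrobenioid.cor38_ofRankOnePoint (h) (hC hC′)` (residual `Prop34Const` only),
  `hull_selfEquivalence_ofRankOnePoint` (abc-iut-L1-t12's hull lift, every input a theorem; `Φ` non-dilating := abc-iut-w6-d052's
  `ofRankOnePoint_nonDilating`), `exists_cor38Hyp_cor38_i_ii_ofRankOnePoint`;
* §3 **the MODEL OF RECORD**: `TateTowerFrd.hull_selfEquivalence_temperedFrobenioid`, **`TateTowerFrd.cor38_temperedFrobenioid (h) :
  Cor38_i … h ∧ Cor38_ii … h ∧ Cor38_iii h` with NO binder beyond `h`**, `exists_cor38Hyp_cor38_temperedFrobenioid`;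
* §4 **the ONE-COMPONENT model**: **`OneCompFrd.cor38_temperedFrobenioidWeak (h) : … ∧ … ∧ …` with NO binder** (`Prop34Const` :=
  this seat's `OneCompFrd.prop34Const_dm`), `exists_…`, and `exists_…₁` at abc-iut-w6-d048's parameter-free instance `U := PUnit`.

READING: [EtTh] Cor. 3.8 (i), (ii), (iii) AS TYPED hold simultaneously and unconditionally at NON-DEGENERATE constructed tempered
Frobenioids of the cell (genuine `D₀` = connected `G`-sets with Galois content over abc-iut-w6-d058's `LogDivisorModel`s; print's
`p`-adic Frobenioid of the base field at the bottom of the tower, [FrdII] Ex. 1.1 / [EtTh] Ex. 3.9), complementing the degenerate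
`WeakPiNat` witnesses (p445706 / p446212 / p447049, infinitely many components).  HONEST LABEL: instantiation / consistency
certificates (each witness lives over ONE point of `D₀`); `LogDivisorModel` / `GaloisAction` are parameter records; refereed pre-IUT
material; nothing here bears on [IUTchIII] Cor. 3.12; no side taken; typed ≠ proved.
-/

noncomputable section

namespace Literature.AnabelianGeometry.EtaleTheta

open CategoryTheory Opposite Function Literature.AlgebraicGeometry.Frobenioids
  Literature.AnabelianGeometry.SemiGraphs LogDivisorModel LogDivisorModel.GaloisAction

universe u u' v'

namespace Cor38Hyp

/-! ## §1 The generic connected data: (i) ∧ (ii) ∧ (iii) -/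

section ConnectedFSM

variable {Z : LogDivisorModel.{u}} {G : Type u} [Group G] {A : Z.GaloisAction G} {hZ : Z.CuspLaws}
  {hpf : ∀ Y : ((isConnectedGSet (G := G)).FullSubcategory)ᵒᵖ,
    IsPerfFactorialCof ((DivisorMonoids.ofGaloisActionConnected A hZ).Φ₀.obj Y)}
  {Z' : LogDivisorModel.{u}} {G' : Type u} [Group G'] {A' : Z'.GaloisAction G'} {hZ' : Z'.CuspLaws}
  {hpf' : ∀ Y : ((isConnectedGSet (G := G')).FullSubcategory)ᵒᵖ,
    IsPerfFactorialCof ((DivisorMonoids.ofGaloisActionConnected A' hZ').Φ₀.obj Y)}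
  {D : Type u'} [Category.{v'} D] {IsRational IsStrictlyRational : (Dᵒᵖ ⥤ CommMonCat.{u}) → Prop}
  {D' : Type u'} [Category.{v'} D'] {IsRational' IsStrictlyRational' : (D'ᵒᵖ ⥤ CommMonCat.{u}) → Prop}
  {C₁ : TemperedFrobenioid
    (RealifiedDivisorMonoids.ofRlfZWeak (DivisorMonoids.ofGaloisActionConnected A hZ) hpf) D
    (treeCatVocab D IsRational IsStrictlyRational)}
  {C₂ : TemperedFrobenioid
    (RealifiedDivisorMonoids.ofRlfZWeak (DivisorMonoids.ofGaloisActionConnected A' hZ') hpf') D'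
    (treeCatVocab D' IsRational' IsStrictlyRational')}

/-- **[EtTh] Cor. 3.8 (i) ∧ (ii) ∧ (iii) AS TYPED at the constructed connected data over bases of FSM-type** ((i)/(ii) = this seat's
p449574, (iii) = abc-iut-w6-d052's knit; countable `G`, cusps, components): residual = the Cor. 3.8 datum `h`, the Φ-ties (print's
`Φ`), `Prop34Const_i` (G-L2d2-3), `IsOfFSMType D_i` — NOTHING ELSE. [cite: MochizukiEtTh2009, Cor 3.8 p.80] -/
theorem cor38_ofGaloisActionConnected_of_isOfFSMType_of_eq_mrange
    [Countable G] [Countable Z.Cusp] [Countable Z.Comp] [Countable G'] [Countable Z'.Cusp] [Countable Z'.Comp]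
    (h : Cor38Hyp C₁ C₂) (hD : IsOfFSMType D) (hD' : IsOfFSMType D')
    (hΦ₁ : ∀ B : Dᵒᵖ, C₁.Φ.carrier B = MonoidHom.mrange (hpf (C₁.baseOp B)).weak.toRealification)
    (hΦ₂ : ∀ B : D'ᵒᵖ, C₂.Φ.carrier B = MonoidHom.mrange (hpf' (C₂.baseOp B)).weak.toRealification)
    (hC₁ : (DivisorMonoids.ofGaloisActionConnected A hZ).Prop34Const)
    (hC₂ : (DivisorMonoids.ofGaloisActionConnected A' hZ').Prop34Const) :
    Literature.AnabelianGeometry.EtaleTheta.Cor38_i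
        (fun E _ => Literature.AlgebraicGeometry.Frobenioids.IsFrobeniusSlim E) h ∧
      Literature.AnabelianGeometry.EtaleTheta.Cor38_ii
        (fun E _ Φ => ∀ (B : E) (α : Aut (Over.forget B)),
          (∀ (B' : Over B) (x : Φ.obj (op B'.left)),
            Literature.AlgebraicGeometry.Frobenioids.pull Φ (α.hom.app B') x = x) → α = 1) h ∧
      Cor38_iii h :=
  ⟨h.cor38_i_ofGaloisActionConnected_of_isOfFSMType_of_eq_mrange hD hD' hΦ₁ hΦ₂ hC₁ hC₂,
    h.cor38_ii_ofGaloisActionConnected_of_isOfFSMType_of_eq_mrange hD hD' hΦ₁ hΦ₂ hC₁ hC₂,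
    cor38_iii_ofGaloisActionConnected_of_isOfFSMType_of_eq_mrange h hD hD' hΦ₁ hΦ₂ hC₁ hC₂⟩

end ConnectedFSM

section ConnectedGenuineBase

variable {Z : LogDivisorModel.{u}} {G : Type u} [Group G] {A : Z.GaloisAction G} {hZ : Z.CuspLaws}
  {hpf : ∀ Y : ((isConnectedGSet (G := G)).FullSubcategory)ᵒᵖ,
    IsPerfFactorialCof ((DivisorMonoids.ofGaloisActionConnected A hZ).Φ₀.obj Y)}
  {Z' : LogDivisorModel.{u}} {G' : Type u} [Group G'] {A' : Z'.GaloisAction G'} {hZ' : Z'.CuspLaws}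
  {hpf' : ∀ Y : ((isConnectedGSet (G := G')).FullSubcategory)ᵒᵖ,
    IsPerfFactorialCof ((DivisorMonoids.ofGaloisActionConnected A' hZ').Φ₀.obj Y)}
  {P : Type v'} [Group P] [TopologicalSpace P]
  {IsRational IsStrictlyRational : ((ConnectedPart (BTemp P))ᵒᵖ ⥤ CommMonCat.{u}) → Prop}
  {P' : Type v'} [Group P'] [TopologicalSpace P']
  {IsRational' IsStrictlyRational' : ((ConnectedPart (BTemp P'))ᵒᵖ ⥤ CommMonCat.{u}) → Prop}
  {C₁ : TemperedFrobenioid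
    (RealifiedDivisorMonoids.ofRlfZWeak (DivisorMonoids.ofGaloisActionConnected A hZ) hpf)
    (ConnectedPart (BTemp P)) (treeCatVocab (ConnectedPart (BTemp P)) IsRational IsStrictlyRational)}
  {C₂ : TemperedFrobenioid
    (RealifiedDivisorMonoids.ofRlfZWeak (DivisorMonoids.ofGaloisActionConnected A' hZ') hpf')
    (ConnectedPart (BTemp P')) (treeCatVocab (ConnectedPart (BTemp P')) IsRational' IsStrictlyRational')}

/-- **[EtTh] Cor. 3.8 (i) ∧ (ii) ∧ (iii) AS TYPED at the constructed connected data over the GENUINE bases `B^temp(Π)⁰`, `B^temp(Π′)⁰`**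
(any topological groups `Π`, `Π′`): residual = `h`, the Φ-ties, `Prop34Const_i` — nothing else. [cite: MochizukiEtTh2009, Cor 3.8 p.80] -/
theorem cor38_ofGaloisActionConnected_connectedPart_bTemp_of_eq_mrange
    [Countable G] [Countable Z.Cusp] [Countable Z.Comp] [Countable G'] [Countable Z'.Cusp] [Countable Z'.Comp]
    (h : Cor38Hyp C₁ C₂)
    (hΦ₁ : ∀ B : (ConnectedPart (BTemp P))ᵒᵖ,
      C₁.Φ.carrier B = MonoidHom.mrange (hpf (C₁.baseOp B)).weak.toRealification)
    (hΦ₂ : ∀ B : (ConnectedPart (BTemp P'))ᵒᵖ,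
      C₂.Φ.carrier B = MonoidHom.mrange (hpf' (C₂.baseOp B)).weak.toRealification)
    (hC₁ : (DivisorMonoids.ofGaloisActionConnected A hZ).Prop34Const)
    (hC₂ : (DivisorMonoids.ofGaloisActionConnected A' hZ').Prop34Const) :
    Literature.AnabelianGeometry.EtaleTheta.Cor38_i
        (fun E _ => Literature.AlgebraicGeometry.Frobenioids.IsFrobeniusSlim E) h ∧
      Literature.AnabelianGeometry.EtaleTheta.Cor38_ii
        (fun E _ Φ => ∀ (B : E) (α : Aut (Over.forget B)),
          (∀ (B' : Over B) (x : Φ.obj (op B'.left)),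
            Literature.AlgebraicGeometry.Frobenioids.pull Φ (α.hom.app B') x = x) → α = 1) h ∧
      Cor38_iii h :=
  ⟨h.cor38_i_ofGaloisActionConnected_connectedPart_bTemp_of_eq_mrange hΦ₁ hΦ₂ hC₁ hC₂,
    h.cor38_ii_ofGaloisActionConnected_connectedPart_bTemp_of_eq_mrange hΦ₁ hΦ₂ hC₁ hC₂,
    cor38_iii_ofGaloisActionConnected_connectedPart_bTemp_of_eq_mrange h hΦ₁ hΦ₂ hC₁ hC₂⟩

end ConnectedGenuineBase

end Cor38Hyp

/-! ## §2 Rank-one points -/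

namespace TemperedFrobenioid

section RankOnePair

variable {Z : LogDivisorModel.{0}} {G : Type} [Group G] {A : Z.GaloisAction G} (hZ : Z.CuspLaws) (P : RankOnePoint A)
  (hpf : ∀ Y : ((isConnectedGSet (G := G)).FullSubcategory)ᵒᵖ,
    IsPerfFactorialCof ((DivisorMonoids.ofGaloisActionConnected A hZ).Φ₀.obj Y))
  (R S : ((Discrete PUnit.{1})ᵒᵖ ⥤ CommMonCat.{0}) → Prop)
  {Z' : LogDivisorModel.{0}} {G' : Type} [Group G'] {A' : Z'.GaloisAction G'} (hZ' : Z'.CuspLaws)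
  (P' : RankOnePoint A')
  (hpf' : ∀ Y : ((isConnectedGSet (G := G')).FullSubcategory)ᵒᵖ,
    IsPerfFactorialCof ((DivisorMonoids.ofGaloisActionConnected A' hZ').Φ₀.obj Y))
  (R' S' : ((Discrete PUnit.{1})ᵒᵖ ⥤ CommMonCat.{0}) → Prop)

/-- **[EtTh] Cor. 3.8 (i) ∧ (ii) ∧ (iii) AS TYPED for every such `h`, modulo `Prop34Const` of the two Def. 3.3 (iii) records ONLY**
((iii) = abc-iut-w6-d052's `cor38_iii_ofRankOnePoint`, R365; countable `G`, cusps, components). [cite: MochizukiEtTh2009, Cor 3.8 p.80] -/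
theorem cor38_ofRankOnePoint [Countable G] [Countable Z.Cusp] [Countable Z.Comp] [Countable G'] [Countable Z'.Cusp]
    [Countable Z'.Comp] (h : Cor38Hyp (ofRankOnePoint hZ P hpf R S) (ofRankOnePoint hZ' P' hpf' R' S'))
    (hC : (DivisorMonoids.ofGaloisActionConnected A hZ).Prop34Const)
    (hC' : (DivisorMonoids.ofGaloisActionConnected A' hZ').Prop34Const) :
    Literature.AnabelianGeometry.EtaleTheta.Cor38_i
        (fun E _ => Literature.AlgebraicGeometry.Frobenioids.IsFrobeniusSlim E) h ∧
      Literature.AnabelianGeometry.EtaleTheta.Cor38_ii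
        (fun E _ Φ => ∀ (A : E) (α : Aut (Over.forget A)),
          (∀ (B : Over A) (x : Φ.obj (op B.left)),
            Literature.AlgebraicGeometry.Frobenioids.pull Φ (α.hom.app B) x = x) → α = 1) h ∧
      Cor38_iii h :=
  ⟨cor38_i_ofRankOnePoint hZ P hpf R S hZ' P' hpf' R' S' h, cor38_ii_ofRankOnePoint hZ P hpf R S hZ' P' hpf' R' S' h,
    cor38_iii_ofRankOnePoint hZ P hpf R S hZ' P' hpf' R' S' h hC hC'⟩

end RankOnePair

section RankOneSelf

variable {Z : LogDivisorModel.{0}} {G : Type} [Group G] {A : Z.GaloisAction G} (hZ : Z.CuspLaws) (P : RankOnePoint A)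
  (hpf : ∀ Y : ((isConnectedGSet (G := G)).FullSubcategory)ᵒᵖ,
    IsPerfFactorialCof ((DivisorMonoids.ofGaloisActionConnected A hZ).Φ₀.obj Y))
  (R S : ((Discrete PUnit.{1})ᵒᵖ ⥤ CommMonCat.{0}) → Prop)

/-- **[EtTh] Cor. 3.8 (ii) for EVERY self-equivalence `e` of a rank-one-point witness** (no `Cor38Hyp` packaging left to the
reader): `e` preserves the base-field-theoretic morphisms and lifts compatibly to a self-equivalence of the real hull category —
abc-iut-L1-t12's `hull_selfEquivalence_weak_of_coord` with every input a theorem. [cite: MochizukiEtTh2009, Cor 3.8 p.81] -/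
theorem hull_selfEquivalence_ofRankOnePoint
    (e : (ofRankOnePoint hZ P hpf R S).category ≌ (ofRankOnePoint hZ P hpf R S).category) :
    (∀ {X Y : (ofRankOnePoint hZ P hpf R S).category} (f : X ⟶ Y),
        (ofRankOnePoint hZ P hpf R S).IsBaseFieldTheoretic f ↔
          (ofRankOnePoint hZ P hpf R S).IsBaseFieldTheoretic (e.functor.map f)) ∧
      ∃ e' : (ofRankOnePoint hZ P hpf R S).hullCategory ≌ (ofRankOnePoint hZ P hpf R S).hullCategory,
        Nonempty ((ofRankOnePoint hZ P hpf R S).hull ⋙ e.functor ≅ e'.functor ⋙ (ofRankOnePoint hZ P hpf R S).hull) :=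
  (ofRankOnePoint hZ P hpf R S).hull_selfEquivalence_weak_of_coord PadicFrd.isOfFSMType_discretePUnit.isOfFSMFFType
    (ofRankOnePoint_nonDilating hZ P hpf R S) (Toy.isDivSlim45iv_discretePUnit _) (isFrobenioid_ofRankOnePoint hZ P hpf R S)
    (hP34Λ_ofGaloisActionConnected_weak A hZ hpf) (exists_cnstFn_effective_ofRankOnePoint hZ P hpf R S)
    (hQ_ofRankOnePoint hZ P hpf R S) (hFinv_ofGaloisActionConnected_weak A hZ hpf) e

/-- **The typed statements of the nodes `EtTh:Cor3.8(i)` and `(ii)` have an unconditional kernel instance at every rank-one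
point** (inhabitant `nonempty_cor38Hyp_ofRankOnePoint`, `Ψ := 𝟭`). [cite: MochizukiEtTh2009, Cor 3.8 p.80] -/
theorem exists_cor38Hyp_cor38_i_ii_ofRankOnePoint :
    ∃ h : Cor38Hyp (ofRankOnePoint hZ P hpf R S) (ofRankOnePoint hZ P hpf R S),
      Literature.AnabelianGeometry.EtaleTheta.Cor38_i
          (fun E _ => Literature.AlgebraicGeometry.Frobenioids.IsFrobeniusSlim E) h ∧
        Literature.AnabelianGeometry.EtaleTheta.Cor38_ii
          (fun E _ Φ => ∀ (A : E) (α : Aut (Over.forget A)),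
            (∀ (B : Over A) (x : Φ.obj (op B.left)),
              Literature.AlgebraicGeometry.Frobenioids.pull Φ (α.hom.app B) x = x) → α = 1) h := by
  obtain ⟨h⟩ := nonempty_cor38Hyp_ofRankOnePoint hZ P hpf R S
  exact ⟨h, cor38_i_ii_ofRankOnePoint hZ P hpf R S hZ P hpf R S h⟩

end RankOneSelf

end TemperedFrobenioid

/-! ## §3 The model of record: the Tate tower -/

namespace TateTowerFrd

variable (R S R' S' : ((Discrete PUnit.{1})ᵒᵖ ⥤ CommMonCat.{0}) → Prop)

/-- [EtTh] Cor. 3.8 (ii) for every self-equivalence of the model-of-record witness (hull lift).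
[cite: MochizukiEtTh2009, Cor 3.8 p.81] -/
theorem hull_selfEquivalence_temperedFrobenioid
    (e : (temperedFrobenioid R S).category ≌ (temperedFrobenioid R S).category) :
    (∀ {X Y : (temperedFrobenioid R S).category} (f : X ⟶ Y),
        (temperedFrobenioid R S).IsBaseFieldTheoretic f ↔ (temperedFrobenioid R S).IsBaseFieldTheoretic (e.functor.map f)) ∧
      ∃ e' : (temperedFrobenioid R S).hullCategory ≌ (temperedFrobenioid R S).hullCategory,
        Nonempty ((temperedFrobenioid R S).hull ⋙ e.functor ≅ e'.functor ⋙ (temperedFrobenioid R S).hull) :=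
  TemperedFrobenioid.hull_selfEquivalence_ofRankOnePoint _ _ _ R S e

/-- **[EtTh] Cor. 3.8 (i) ∧ (ii) ∧ (iii) AS TYPED at the MODEL OF RECORD, for every `h`, with NO binder beyond `h`** ((iii) =
abc-iut-w6-d052's `LogDivisorModel.TateTower.cor38_iii_tateTowerFrd` (R365) with its only residual, the tower's `Prop34Const`,
DISCHARGED by their `LogDivisorModel.TateTower.prop34Const_ofGaloisActionConnected`, p448109). [cite: MochizukiEtTh2009, Cor 3.8 p.80] -/
theorem cor38_temperedFrobenioid (h : Cor38Hyp (temperedFrobenioid R S) (temperedFrobenioid R' S')) :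
    Literature.AnabelianGeometry.EtaleTheta.Cor38_i
        (fun E _ => Literature.AlgebraicGeometry.Frobenioids.IsFrobeniusSlim E) h ∧
      Literature.AnabelianGeometry.EtaleTheta.Cor38_ii
        (fun E _ Φ => ∀ (A : E) (α : Aut (Over.forget A)),
          (∀ (B : Over A) (x : Φ.obj (op B.left)),
            Literature.AlgebraicGeometry.Frobenioids.pull Φ (α.hom.app B) x = x) → α = 1) h ∧
      Cor38_iii h :=
  ⟨cor38_i_temperedFrobenioid R S R' S' h, cor38_ii_temperedFrobenioid R S R' S' h,
    LogDivisorModel.TateTower.cor38_iii_tateTowerFrd R S R' S' h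
      LogDivisorModel.TateTower.prop34Const_ofGaloisActionConnected⟩

/-- **The typed statements of the nodes `EtTh:Cor3.8(i)`, `(ii)`, `(iii)` have a SIMULTANEOUS unconditional kernel instance at the
MODEL OF RECORD** (`Ψ := 𝟭`). [cite: MochizukiEtTh2009, Cor 3.8 p.80] -/
theorem exists_cor38Hyp_cor38_temperedFrobenioid :
    ∃ h : Cor38Hyp (temperedFrobenioid R S) (temperedFrobenioid R S),
      Literature.AnabelianGeometry.EtaleTheta.Cor38_i
          (fun E _ => Literature.AlgebraicGeometry.Frobenioids.IsFrobeniusSlim E) h ∧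
        Literature.AnabelianGeometry.EtaleTheta.Cor38_ii
          (fun E _ Φ => ∀ (A : E) (α : Aut (Over.forget A)),
            (∀ (B : Over A) (x : Φ.obj (op B.left)),
              Literature.AlgebraicGeometry.Frobenioids.pull Φ (α.hom.app B) x = x) → α = 1) h ∧
        Cor38_iii h := by
  obtain ⟨h⟩ := TemperedFrobenioid.nonempty_cor38Hyp_ofRankOnePoint TateTower.cuspLaws rankOnePoint hpf R S
  exact ⟨h, cor38_temperedFrobenioid R S R S h⟩

end TateTowerFrd

/-! ## §4 The one-component model -/

namespace OneCompFrd

variable (U : Type) [CommGroup U] (hU : ∀ u : U, (∀ N : ℕ+, ∃ g : U, g ^ (N : ℕ) = u) → u = 1)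
  (R S R' S' : ((Discrete PUnit.{1})ᵒᵖ ⥤ CommMonCat.{0}) → Prop)

/-- **[EtTh] Cor. 3.8 (i) ∧ (ii) ∧ (iii) AS TYPED with NO binder beyond `h` at the ONE-COMPONENT constructed tempered Frobenioid**
(abc-iut-w6-d048's `OneCompFrd.temperedFrobenioidWeak U hU R S`, p445878): `TemperedFrobenioid.cor38_ofRankOnePoint` with its ONLY residual
`Prop34Const` DISCHARGED by this seat's `OneCompFrd.prop34Const_dm` (p449874) and the countability instances of the model (`G = 1`,
`Cusp = ∅`, `Comp = {F}`). [cite: MochizukiEtTh2009, Cor 3.8 p.80] -/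
theorem cor38_temperedFrobenioidWeak
    (h : Cor38Hyp (temperedFrobenioidWeak U hU R S) (temperedFrobenioidWeak U hU R' S')) :
    Literature.AnabelianGeometry.EtaleTheta.Cor38_i
        (fun E _ => Literature.AlgebraicGeometry.Frobenioids.IsFrobeniusSlim E) h ∧
      Literature.AnabelianGeometry.EtaleTheta.Cor38_ii
        (fun E _ Φ => ∀ (A : E) (α : Aut (Over.forget A)),
          (∀ (B : Over A) (x : Φ.obj (op B.left)),
            Literature.AlgebraicGeometry.Frobenioids.pull Φ (α.hom.app B) x = x) → α = 1) h ∧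
      Cor38_iii h := by
  haveI : Countable (oneComp U hU).Cusp := show Countable PEmpty.{1} from inferInstance
  haveI : Countable (oneComp U hU).Comp := show Countable PUnit.{1} from inferInstance
  exact TemperedFrobenioid.cor38_ofRankOnePoint _ _ _ R S _ _ _ R' S' h (prop34Const_dm U hU) (prop34Const_dm U hU)

/-- **The typed statements of the nodes `EtTh:Cor3.8(i)`, `(ii)`, `(iii)` have a SIMULTANEOUS unconditional kernel instance at the
one-component model** (inhabitant: abc-iut-w6-d052's `nonempty_cor38Hyp_ofRankOnePoint`, `Ψ := 𝟭`). [cite: MochizukiEtTh2009, Cor 3.8 p.80] -/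
theorem exists_cor38Hyp_cor38_temperedFrobenioidWeak :
    ∃ h : Cor38Hyp (temperedFrobenioidWeak U hU R S) (temperedFrobenioidWeak U hU R S),
      Literature.AnabelianGeometry.EtaleTheta.Cor38_i
          (fun E _ => Literature.AlgebraicGeometry.Frobenioids.IsFrobeniusSlim E) h ∧
        Literature.AnabelianGeometry.EtaleTheta.Cor38_ii
          (fun E _ Φ => ∀ (A : E) (α : Aut (Over.forget A)),
            (∀ (B : Over A) (x : Φ.obj (op B.left)),
              Literature.AlgebraicGeometry.Frobenioids.pull Φ (α.hom.app B) x = x) → α = 1) h ∧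
        Cor38_iii h := by
  obtain ⟨h⟩ := TemperedFrobenioid.nonempty_cor38Hyp_ofRankOnePoint (cuspLaws_oneComp U hU) (rankOnePoint U hU)
    (hpfCof_oneComp U hU) R S
  exact ⟨h, cor38_temperedFrobenioidWeak U hU R S R S h⟩

/-- The same at abc-iut-w6-d048's PARAMETER-FREE instance `U := PUnit` (the value-group shadow `L^×/O_L^×`): [EtTh] Cor. 3.8 (i), (ii),
(iii) AS TYPED with no binder and no model parameter left. [cite: MochizukiEtTh2009, Cor 3.8 p.80] -/
theorem exists_cor38Hyp_cor38_temperedFrobenioidWeak₁ :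
    ∃ h : Cor38Hyp (temperedFrobenioidWeak PUnit.{1} (fun _ _ => Subsingleton.elim _ _) R S)
        (temperedFrobenioidWeak PUnit.{1} (fun _ _ => Subsingleton.elim _ _) R S),
      Literature.AnabelianGeometry.EtaleTheta.Cor38_i
          (fun E _ => Literature.AlgebraicGeometry.Frobenioids.IsFrobeniusSlim E) h ∧
        Literature.AnabelianGeometry.EtaleTheta.Cor38_ii
          (fun E _ Φ => ∀ (A : E) (α : Aut (Over.forget A)),
            (∀ (B : Over A) (x : Φ.obj (op B.left)),
              Literature.AlgebraicGeometry.Frobenioids.pull Φ (α.hom.app B) x = x) → α = 1) h ∧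
        Cor38_iii h :=
  exists_cor38Hyp_cor38_temperedFrobenioidWeak PUnit.{1} _ R S

end OneCompFrd

end Literature.AnabelianGeometry.EtaleTheta

end
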